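import Mathlib
import HarnessLib.Audit
import Summits.PneNP.PneNP.Theorems.PstarGateCasePRegimes
import Summits.PneNP.PneNP.Theorems.PstarGateAffine
import Summits.PneNP.PneNP.Theorems.PstarGateTerminal
import Summits.PneNP.PneNP.Theorems.PstarSlotSwap
import Summits.PneNP.PneNP.Theorems.PstarCoupled

/-!
# One GATED chord: the residual nodes N1–N6′ on one-gate bridge data, their COVERAGE, and the link to `TerminalFiveCotree1Blind` (E2; prover-1 g18)

FRONTIER range-avoidance ladder, rung F-N3 (`stmt-PneNP-19007`), cell `pnp-ideate` (planner p3 g23's typing `HOME/pnp-ideate-p3/r25/SketchGateNodes.lean`,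
answering this seat's TYPING REQUEST 2026-08-29T00:48Z; this seat's `HOME/pnp-ideate-prover-1/g18/E2-PLAN.md` §2–§3); restricted-model proof
complexity — nothing here bears on `P` versus `NP`.

STATEMENTS (the planner's, verbatim): `GateData I r B e g₀ u κ₀` — the one-gate bridge-data bundle that `PstarGateTerminal.gateBridge_of_terminal`
delivers from the raw `TerminalFiveCotree1Blind` datum (orientation `p = vars e 2`); the regimes `ReadAlong`, `AllRead`; the residual nodes
N1 `GateCasePNor`, N2 `GateCasePUnits`, N3 `GateOrFamily`, N4 `GateCaseTQuad`, N5 `GateU2`, N6 `GateUnitCycleQuad`, N6′ `GateUnitCycleAffine`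
(each `GateData ⟹ … ⟹ #J₀ ≤ 5`); the common target `GateCount`; the covering claim `GateCoverage`.

PROVED here:
* `gateCoverage_holds : GateCoverage` — the seven nodes exhaust one-gate bridge data (`PstarGateBridge.regime_trichotomy` for `#(N − e) ≥ 2`;
  for `N = {e, e'}` the constant reads of `e'` (`const_of_others`, M-read via `read_of_chordMinimal`) lie on the line of `(1,0)`, of `(0,1)` /
  `(1,1)`, or are independent; `N = {e}` by affine-or-not).
* `gateData_of_terminal` — the raw datum (orientation `vars e 2`) gives `GateData` with `B.J₀ = J₀` (radius WITH footprint from `Terminal`,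
  `u` no private / no XOR vertex by chord privacy and typing, no other `G₁`-monomial on `p` by hun-cleanness).
* `cotree1Blind_of_gateCount : GateCount → TerminalFiveCotree1Blind` — both orientations (slot 3 through the AND-slot swap `PstarSlotSwap.swapAnd I e`,
  an instance symmetry preserving purity, typing, simple overlaps, expansion, `Terminal`, peelability, chords, privates and `gval`).
So (E2) `TerminalFiveCotree1Blind` ⟸ `GateCount` ⟸ N1 ∧ N2 ∧ N3 ∧ N4 ∧ N5 ∧ N6 ∧ N6′: the count is now seven typed finite problems.
Census support (p3 g23, K25 lit k ≤ 6 complete, memo §14.44): 0 admissible data with the gate footprint at #J₀ = 6; all k = 6 data use a σ-share.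
-/

set_option linter.dupNamespace false -- `Summit.PneNP.PneNP.…`: summit = sub-problem name (D-0017 single-conjunct layout)

open Finset Literature.Computability.Complexity
open Summit.PneNP.PneNP.Theorems.PstarTyped (Typed)
open Summit.PneNP.PneNP.Theorems.PstarSALevel (varSet BoundaryExpanding SimpleOverlap)
open Summit.PneNP.PneNP.Theorems.PstarGapPeeling (not_mem_varSet_of_private)
open Summit.PneNP.PneNP.Theorems.PstarCentreFree (vars_mem_varSet)
open Summit.PneNP.PneNP.Theorems.PstarXCore (xverts)
open Summit.PneNP.PneNP.Theorems.PstarGapOneAll (gval)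
open Summit.PneNP.PneNP.Theorems.PstarCoreBound (XorClosed)
open Summit.PneNP.PneNP.Theorems.PstarChordRepair (IsChord)
open Summit.PneNP.PneNP.Theorems.PstarCubeIdeals (IsAffineFn)
open Summit.PneNP.PneNP.Theorems.PstarReadSumset (V2)
open Summit.PneNP.PneNP.Theorems.PstarChordSystem (ChordSystem)
open Summit.PneNP.PneNP.Theorems.PstarChordBridgeTools (privs coef mem_privs)
open Summit.PneNP.PneNP.Theorems.PstarChordBridge (BridgeData sys Solution Lift infeasible_of_not_solution chordMinimal_of_solution_erase)
open Summit.PneNP.PneNP.Theorems.PstarChordBridgeCotree (Peelable)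
open Summit.PneNP.PneNP.Theorems.PstarChordBridgeForcing (gam)
open Summit.PneNP.PneNP.Theorems.PstarChordBridgeBasis (qDir)
open Summit.PneNP.PneNP.Theorems.PstarChordBridgeTerminal (HasConstraints)
open Summit.PneNP.PneNP.Theorems.PstarCoreBoundTargets (Terminal)
open Summit.PneNP.PneNP.Theorems.PstarUnion (SatPair)
open Summit.PneNP.PneNP.Theorems.PstarCoupled (CotreeGate TerminalFiveCotree1Blind)
open Summit.PneNP.PneNP.Theorems.PstarGateBridge (GateHyp const_of_others regime_trichotomy)
open Summit.PneNP.PneNP.Theorems.PstarGateCasePRegimes (NorCert EqCert UnitCert)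
open Summit.PneNP.PneNP.Theorems.PstarGateCompanion (not_mem_xverts_of_and_slot)
open Summit.PneNP.PneNP.Theorems.PstarGateTerminal (gateBridge_of_terminal)
open Summit.PneNP.PneNP.Theorems.PstarSlotSwap

namespace Summit.PneNP.PneNP.Theorems.PstarGateNodes

variable {n m : ℕ}

/-- **The one-gate bridge-data bundle** (everything `gateBridge_of_terminal` + the raw hun-cleanness deliver; orientation `p = vars e 2`). -/
def GateData (I : LocalMap 4 n m) (r : ℕ) (B : BridgeData n m) (e g₀ : Fin m) (u : Fin n) (κ₀ : ZMod 2) : Prop :=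
  B.WF I ∧ (B.J₀ ∪ B.G₁ ∪ B.G₂).card ≤ r ∧ Disjoint B.G₁ B.J₀ ∧ Disjoint B.G₂ B.J₀ ∧ Lift I B ∧ Peelable I (B.J₀ \ B.N) ∧ B.N.Nonempty ∧
  GateHyp I B e ∧ g₀ ∈ B.G₁ ∧
  ((I.vars g₀ 2 = I.vars e 2 ∧ I.vars g₀ 3 = u) ∨ (I.vars g₀ 2 = u ∧ I.vars g₀ 3 = I.vars e 2)) ∧
  (∃ j₀ ∈ B.J₀ \ B.N, u = I.vars j₀ 2 ∨ u = I.vars j₀ 3) ∧ u ∉ privs I B.N ∧ u ∉ xverts I (B.J₀ \ B.N) ∧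
  (∀ g ∈ B.G₁.erase g₀, I.vars g 2 ≠ I.vars e 2 ∧ I.vars g 3 ≠ I.vars e 2) ∧
  (∀ x, coef I B.C₁ B.G₁ (I.vars e 2) x = κ₀ + x u) ∧
  (¬ ∃ z, Solution I B B.J₀ z) ∧ (∀ f ∈ B.J₀, ∃ z, Solution I B (B.J₀.erase f) z)

/-- Every chord other than `e` reads along the direction `mv` (both read vectors on the line of `mv`, at every base point). -/
def ReadAlong (I : LocalMap 4 n m) (B : BridgeData n m) (e : Fin m) (mv : V2) : Prop :=
  ∀ e' ∈ B.N, e' ≠ e → ∀ a, ((sys I B).ρ e' a = 0 ∨ (sys I B).ρ e' a = mv) ∧ ((sys I B).ρ' e' a = 0 ∨ (sys I B).ρ' e' a = mv)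

/-- Every chord other than `e` is read (at every base point). -/
def AllRead (I : LocalMap 4 n m) (B : BridgeData n m) (e : Fin m) : Prop :=
  ∀ e' ∈ B.N, e' ≠ e → ∀ a, (sys I B).ρ e' a ≠ 0 ∨ (sys I B).ρ' e' a ≠ 0

/-- The common target: one-gate bridge data have a core of at most five outputs. -/
@[conjecture] def GateCount : Prop :=
  ∀ (n m r : ℕ) (I : LocalMap 4 n m), I.IsPure xorAndPred → Typed I → SimpleOverlap I → BoundaryExpanding r I →
  ∀ (B : BridgeData n m) (e g₀ : Fin m) (u : Fin n) (κ₀ : ZMod 2), GateData I r B e g₀ u κ₀ → B.J₀.card ≤ 5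

/-- **N1 `GateCasePNor`** — CASE P (the others read along the gate's own direction `(1,0)`), and SOME other chord is (NOR) w.r.t. `q_{(1,0)}`
(then all are: `caseP_regimes`, first branch).  Expected EMPTY beyond 5: NOR cores are slack-tight and the gate footprint costs 3. -/
@[conjecture] def GateCasePNor : Prop :=
  ∀ (n m r : ℕ) (I : LocalMap 4 n m), I.IsPure xorAndPred → Typed I → SimpleOverlap I → BoundaryExpanding r I →
  ∀ (B : BridgeData n m) (e g₀ : Fin m) (u : Fin n) (κ₀ : ZMod 2), GateData I r B e g₀ u κ₀ →
    ReadAlong I B e (1, 0) → AllRead I B e →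
    (∃ e' ∈ B.N, e' ≠ e ∧ NorCert I B (B.D e') (gam B e')) →
    B.J₀.card ≤ 5

/-- **N2 `GateCasePUnits`** — CASE P, at least one other chord, and NO other chord is (NOR): by `caseP_regimes` the others are ≤ 2, each (EQ) or an
EXC-unit, at most one of each. -/
@[conjecture] def GateCasePUnits : Prop :=
  ∀ (n m r : ℕ) (I : LocalMap 4 n m), I.IsPure xorAndPred → Typed I → SimpleOverlap I → BoundaryExpanding r I →
  ∀ (B : BridgeData n m) (e g₀ : Fin m) (u : Fin n) (κ₀ : ZMod 2), GateData I r B e g₀ u κ₀ →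
    ReadAlong I B e (1, 0) → AllRead I B e → (B.N.erase e).Nonempty →
    (∀ e' ∈ B.N, e' ≠ e → ¬ NorCert I B (B.D e') (gam B e')) →
    B.J₀.card ≤ 5

/-- **N3 `GateOrFamily`** — CASE T (`mv ∈ {(0,1), (1,1)}`) with `q_mv` AFFINE and at least one other chord: `q_mv + ℓ ≡ 1`
(`PstarGateAffine.caseT_affine_const`), the OR-reader family `w₁ = (x_u ∨ x_p) + c`; contains PIN+GATE and the k = 5 K4−e hits. -/
@[conjecture] def GateOrFamily : Prop :=
  ∀ (n m r : ℕ) (I : LocalMap 4 n m), I.IsPure xorAndPred → Typed I → SimpleOverlap I → BoundaryExpanding r I →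
  ∀ (B : BridgeData n m) (e g₀ : Fin m) (u : Fin n) (κ₀ : ZMod 2), GateData I r B e g₀ u κ₀ →
    ∀ mv : V2, (mv = (0, 1) ∨ mv = (1, 1)) → ReadAlong I B e mv → AllRead I B e → (B.N.erase e).Nonempty →
    IsAffineFn (qDir I B mv) →
    B.J₀.card ≤ 5

/-- **N4 `GateCaseTQuad`** — CASE T with `q_mv` NOT affine and at least one other chord (each other chord EQ/EXC/NOR w.r.t. `q_mv + ℓ` by
`caseT_forced_on_Z` + forcing; `caseT_chord_local`: triangle/square through the `u`-edges). -/
@[conjecture] def GateCaseTQuad : Prop :=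
  ∀ (n m r : ℕ) (I : LocalMap 4 n m), I.IsPure xorAndPred → Typed I → SimpleOverlap I → BoundaryExpanding r I →
  ∀ (B : BridgeData n m) (e g₀ : Fin m) (u : Fin n) (κ₀ : ZMod 2), GateData I r B e g₀ u κ₀ →
    ∀ mv : V2, (mv = (0, 1) ∨ mv = (1, 1)) → ReadAlong I B e mv → AllRead I B e → (B.N.erase e).Nonempty →
    ¬ IsAffineFn (qDir I B mv) →
    B.J₀.card ≤ 5

/-- **N5 `GateU2`** — exactly one other chord `e'`, read in two INDEPENDENT directions (its two constant read vectors are non-zero and distinct),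
so neither CASE P nor CASE T. -/
@[conjecture] def GateU2 : Prop :=
  ∀ (n m r : ℕ) (I : LocalMap 4 n m), I.IsPure xorAndPred → Typed I → SimpleOverlap I → BoundaryExpanding r I →
  ∀ (B : BridgeData n m) (e g₀ : Fin m) (u : Fin n) (κ₀ : ZMod 2), GateData I r B e g₀ u κ₀ →
    ∀ e' : Fin m, B.N = {e, e'} → e' ≠ e →
    (∀ a, (sys I B).ρ e' a ≠ 0 ∧ (sys I B).ρ' e' a ≠ 0 ∧ (sys I B).ρ e' a ≠ (sys I B).ρ' e' a) →
    B.J₀.card ≤ 5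

/-- **N6 `GateUnitCycleQuad`** — the gated chord is the only chord (`J₀ = D e + e`, one cycle) and `q_{(1,0)} = F₂ + t₂` is NOT affine. -/
@[conjecture] def GateUnitCycleQuad : Prop :=
  ∀ (n m r : ℕ) (I : LocalMap 4 n m), I.IsPure xorAndPred → Typed I → SimpleOverlap I → BoundaryExpanding r I →
  ∀ (B : BridgeData n m) (e g₀ : Fin m) (u : Fin n) (κ₀ : ZMod 2), GateData I r B e g₀ u κ₀ →
    B.N = {e} → ¬ IsAffineFn (qDir I B (1, 0)) →
    B.J₀.card ≤ 5

/-- **N6′ `GateUnitCycleAffine`** — the gated chord is the only chord and `q_{(1,0)}` IS affine (one-literal pin: `card_eq_three_of_pin`; the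
multi-literal pins `q = Σ x_σ + κ` are what remains). -/
@[conjecture] def GateUnitCycleAffine : Prop :=
  ∀ (n m r : ℕ) (I : LocalMap 4 n m), I.IsPure xorAndPred → Typed I → SimpleOverlap I → BoundaryExpanding r I →
  ∀ (B : BridgeData n m) (e g₀ : Fin m) (u : Fin n) (κ₀ : ZMod 2), GateData I r B e g₀ u κ₀ →
    B.N = {e} → IsAffineFn (qDir I B (1, 0)) →
    B.J₀.card ≤ 5

/-- **Coverage** (to be proved by the prover; tools: `regime_trichotomy`, `const_of_others`, the M-read of a minimal other chord): the seven
nodes exhaust one-gate bridge data.  With `#(N ∖ e) ≥ 2` the trichotomy gives CASE P (`(1,0)`: N1/N2 by `NorCert` yes/no) or CASE T (N3/N4 by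
affine yes/no); with `N = {e, e'}` the constant reads of `e'` are on the line of `(1,0)` (N1/N2), on the line of `(0,1)` or `(1,1)` (N3/N4), or
independent (N5); with `N = {e}`: N6/N6′. -/
def GateCoverage : Prop :=
  GateCasePNor → GateCasePUnits → GateOrFamily → GateCaseTQuad → GateU2 → GateUnitCycleQuad → GateUnitCycleAffine → GateCount


/-! ## Coverage -/

/-- The sixteen cases of two read vectors, one of them non-zero: on a common line through `0`, or independent. -/
theorem v2_line_or_indep : ∀ r r' : V2, (r ≠ 0 ∨ r' ≠ 0) →
    (∃ mv : V2, (mv = (1, 0) ∨ mv = (0, 1) ∨ mv = (1, 1)) ∧ (r = 0 ∨ r = mv) ∧ (r' = 0 ∨ r' = mv)) ∨ (r ≠ 0 ∧ r' ≠ 0 ∧ r ≠ r') := by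
  decide

/-- **Coverage**: the seven nodes exhaust one-gate bridge data. -/
theorem gateCoverage_holds : GateCoverage := by
  intro h1 h2 h3 h4 h5 h6 h6' n m r I hI hT hS hB B e g₀ u κ₀ hD
  classical
  obtain ⟨hW, hr, -, -, hL, -, -, hG, -, -, -, -, -, -, -, hT3, hM0⟩ := id hD
  have he : e ∈ B.N := hG.1
  have hJr : B.J₀.card ≤ r := (card_le_card (subset_union_left.trans subset_union_left)).trans hr
  have hconst := const_of_others I hW hG
  have hinf : (sys I B).Infeasible B.N := infeasible_of_not_solution I hI hT hW hL hT3
  have hM0N : ∀ f ∈ B.N, ∃ z, Solution I B (B.J₀.erase f) z := fun f hf => hM0 f (hW.hN hf)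
  -- every other chord is read, everywhere (M-read + constancy)
  have hread : AllRead I B e := by
    intro e' he' hne a
    obtain ⟨z, hz⟩ := hM0N e' he'
    obtain ⟨a₀, -, -, -, hR⟩ := (sys I B).read_of_chordMinimal hinf he' (chordMinimal_of_solution_erase I hI hT hW he' hz)
    unfold ChordSystem.Read at hR
    rw [(hconst e' he' hne a a₀).1, (hconst e' he' hne a a₀).2]
    exact hR
  -- the two dispatchers
  have caseP : ReadAlong I B e (1, 0) → (B.N.erase e).Nonempty → B.J₀.card ≤ 5 := by
    intro hRA hne
    by_cases hnor : ∃ e' ∈ B.N, e' ≠ e ∧ NorCert I B (B.D e') (gam B e')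
    · exact h1 n m r I hI hT hS hB B e g₀ u κ₀ hD hRA hread hnor
    · push Not at hnor
      exact h2 n m r I hI hT hS hB B e g₀ u κ₀ hD hRA hread hne hnor
  have caseT : ∀ mv : V2, (mv = (0, 1) ∨ mv = (1, 1)) → ReadAlong I B e mv → (B.N.erase e).Nonempty → B.J₀.card ≤ 5 := by
    intro mv hmv hRA hne
    by_cases haff : IsAffineFn (qDir I B mv)
    · exact h3 n m r I hI hT hS hB B e g₀ u κ₀ hD mv hmv hRA hread hne haff
    · exact h4 n m r I hI hT hS hB B e g₀ u κ₀ hD mv hmv hRA hread hne haff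
  have hothers : ∀ f ∈ B.N, f ≠ e → f ∈ B.N.erase e := fun f hf hfe => mem_erase.2 ⟨hfe, hf⟩
  rcases Nat.lt_or_ge (B.N.erase e).card 2 with hlt | hge
  · rcases Nat.lt_or_ge (B.N.erase e).card 1 with h0 | h1'
    · -- `N = {e}`
      have h0' : B.N.erase e = ∅ := card_eq_zero.1 (by omega)
      have hNe : B.N = {e} := by
        ext f
        rw [mem_singleton]
        refine ⟨fun hf => ?_, fun hf => hf ▸ he⟩
        by_contra hfe
        have h := hothers f hf hfe
        rw [h0'] at h
        exact notMem_empty _ h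
      by_cases haff : IsAffineFn (qDir I B (1, 0))
      · exact h6' n m r I hI hT hS hB B e g₀ u κ₀ hD hNe haff
      · exact h6 n m r I hI hT hS hB B e g₀ u κ₀ hD hNe haff
    · -- exactly one other chord `e'`
      obtain ⟨e', he'⟩ := card_eq_one.1 (show (B.N.erase e).card = 1 by omega)
      have he'mem : e' ∈ B.N.erase e := by rw [he']; exact mem_singleton_self _
      obtain ⟨hne, he'N⟩ := mem_erase.1 he'mem
      have huniq : ∀ f ∈ B.N, f ≠ e → f = e' := fun f hf hfe => by
        have h := hothers f hf hfe
        rw [he'] at h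
        exact mem_singleton.1 h
      have hNe : B.N = {e, e'} := by
        ext f
        rw [mem_insert, mem_singleton]
        refine ⟨fun hf => ?_, ?_⟩
        · by_cases hfe : f = e
          · exact Or.inl hfe
          · exact Or.inr (huniq f hf hfe)
        · rintro (rfl | rfl)
          exacts [he, he'N]
      rcases v2_line_or_indep ((sys I B).ρ e' 0) ((sys I B).ρ' e' 0) (hread e' he'N hne 0) with ⟨mv, hmv, hrm, hr'm⟩ | ⟨hr0, hr'0, hrr'⟩
      · have hRA : ReadAlong I B e mv := by
          intro f hf hfe a
          rw [huniq f hf hfe, (hconst e' he'N hne a 0).1, (hconst e' he'N hne a 0).2]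
          exact ⟨hrm, hr'm⟩
        rcases hmv with rfl | hmv'
        · exact caseP hRA ⟨e', he'mem⟩
        · exact caseT mv hmv' hRA ⟨e', he'mem⟩
      · exact h5 n m r I hI hT hS hB B e g₀ u κ₀ hD e' hNe hne fun a => by
          rw [(hconst e' he'N hne a 0).1, (hconst e' he'N hne a 0).2]; exact ⟨hr0, hr'0, hrr'⟩
  · -- at least two other chords: the trichotomy
    rcases regime_trichotomy I hI hT hS hB hW hJr hL hG hT3 hM0N with hle | ⟨mv, -, hRA, -, hmv⟩
    · omega
    have hne : (B.N.erase e).Nonempty := card_pos.1 (by omega)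
    rcases hmv with rfl | hmv'
    · exact caseP hRA hne
    · exact caseT mv hmv' hRA hne

/-! ## The link to the raw datum -/

/-- **`GateData` from the raw `TerminalFiveCotree1Blind` datum**, orientation `p = vars e 2` (`PstarGateTerminal.gateBridge_of_terminal` + the
footprint radius from `Terminal`, `u` no private / no XOR vertex, hun-cleanness on `p`). -/
theorem gateData_of_terminal (I : LocalMap 4 n m) (hI : I.IsPure xorAndPred) (hT : Typed I) (hS : SimpleOverlap I) {r : ℕ}
    (hB : BoundaryExpanding r I) {y : Fin m → Bool} {J₀ : Finset (Fin m)} {w₁ w₂ : Finset (Fin n) × Finset (Fin m) × Bool}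
    (ht : Terminal I r y J₀ w₁ w₂) {F : Finset (Fin m)} (hF : F ⊆ J₀) (hP : Peelable I F)
    (hmax : ∀ F', F ⊆ F' → F' ⊆ J₀ → Peelable I F' → F' = F) (hch : ∀ e ∈ J₀ \ F, IsChord I J₀ e)
    {e : Fin m} (he : e ∈ J₀ \ F) {g₀ : Fin m} (hg₀ : g₀ ∈ w₁.2.1) {u : Fin n}
    (hgv : (I.vars g₀ 2 = I.vars e 2 ∧ I.vars g₀ 3 = u) ∨ (I.vars g₀ 2 = u ∧ I.vars g₀ 3 = I.vars e 2))
    (hu : ∃ j₀ ∈ F, u = I.vars j₀ 2 ∨ u = I.vars j₀ 3)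
    (hun : ∀ g ∈ (w₁.2.1.erase g₀) ∪ w₂.2.1, ∀ w ∈ privs I (J₀ \ F), I.vars g 2 ≠ w ∧ I.vars g 3 ≠ w)
    (hfv : ∀ c : Bool, SatPair I y J₀ (({I.vars e 2} : Finset (Fin n)), (∅ : Finset (Fin m)), c) w₂)
    (hbl : I.vars e 2 ∉ w₂.1 ∧ I.vars e 3 ∉ w₂.1) :
    ∃ (B : BridgeData n m) (κ₀ : ZMod 2), B.J₀ = J₀ ∧ GateData I r B e g₀ u κ₀ := by
  classical
  obtain ⟨B, -, hJ, hN, hC, hW, hL, hPe, hd₁, hd₂, hNne, hG, hcoef, hT3, hM0⟩ :=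
    gateBridge_of_terminal I hI hT hS hB ht hF hP hmax hch he hg₀ hgv hu hun hfv hbl
  obtain ⟨-, -, -, -, -, hrad, -, -⟩ := id ht
  obtain ⟨-, hG₁, -, -, hG₂, -⟩ := hC
  have hFeq : B.J₀ \ B.N = F := by rw [hJ, hN, Finset.sdiff_sdiff_eq_self hF]
  refine ⟨B, if I.vars e 2 ∈ w₁.1 then 1 else 0, hJ, hW, ?_, hd₁, hd₂, hL, hPe, hNne, hG, ?_, hgv, ?_, ?_, ?_, ?_, hcoef, hT3, hM0⟩
  · rw [hJ, hG₁, hG₂]; exact hrad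
  · rw [hG₁]; exact hg₀
  · rw [hFeq]; exact hu
  · -- `u` is no private: it is held by the tree edge `j₀`
    obtain ⟨j₀, hj₀, hju⟩ := hu
    have hu_vs : u ∈ varSet I j₀ := by rcases hju with h | h <;> rw [h] <;> exact vars_mem_varSet I j₀ _
    rw [hN]
    intro hup
    obtain ⟨e', he', hv⟩ := (mem_privs I).1 hup
    have hje : j₀ ≠ e' := fun h => (mem_sdiff.1 he').2 (h ▸ hj₀)
    rcases hv with h | h
    · exact not_mem_varSet_of_private I (mem_sdiff.1 he').1 (hF hj₀) hje (hch e' he').1 (vars_mem_varSet I e' 2) (h ▸ hu_vs)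
    · exact not_mem_varSet_of_private I (mem_sdiff.1 he').1 (hF hj₀) hje (hch e' he').2 (vars_mem_varSet I e' 3) (h ▸ hu_vs)
  · obtain ⟨j₀, -, hju⟩ := hu
    rcases hju with h | h
    · exact not_mem_xverts_of_and_slot I hT _ (Or.inl h.symm)
    · exact not_mem_xverts_of_and_slot I hT _ (Or.inr h.symm)
  · rw [hG₁]
    intro g hg
    exact hun g (mem_union_left _ hg) _ ((mem_privs I).2 ⟨e, he, Or.inl rfl⟩)

/-- The orientation-`2` half of the link: the gate's private is `vars e 2`. -/
theorem card_le_five_of_gateCount₂ (hC : GateCount) (I : LocalMap 4 n m) (hI : I.IsPure xorAndPred) (hT : Typed I) (hS : SimpleOverlap I)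
    {r : ℕ} (hB : BoundaryExpanding r I) {y : Fin m → Bool} {J₀ : Finset (Fin m)} {w₁ w₂ : Finset (Fin n) × Finset (Fin m) × Bool}
    (ht : Terminal I r y J₀ w₁ w₂) {F : Finset (Fin m)} (hF : F ⊆ J₀) (hP : Peelable I F)
    (hmax : ∀ F', F ⊆ F' → F' ⊆ J₀ → Peelable I F' → F' = F) (hch : ∀ e ∈ J₀ \ F, IsChord I J₀ e)
    {e : Fin m} (he : e ∈ J₀ \ F) {g₀ : Fin m} (hg₀ : g₀ ∈ w₁.2.1) {u : Fin n}
    (hgv : (I.vars g₀ 2 = I.vars e 2 ∧ I.vars g₀ 3 = u) ∨ (I.vars g₀ 2 = u ∧ I.vars g₀ 3 = I.vars e 2))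
    (hu : ∃ j₀ ∈ F, u = I.vars j₀ 2 ∨ u = I.vars j₀ 3)
    (hun : ∀ g ∈ (w₁.2.1.erase g₀) ∪ w₂.2.1, ∀ w ∈ privs I (J₀ \ F), I.vars g 2 ≠ w ∧ I.vars g 3 ≠ w)
    (hfv : ∀ c : Bool, SatPair I y J₀ (({I.vars e 2} : Finset (Fin n)), (∅ : Finset (Fin m)), c) w₂)
    (hbl : I.vars e 2 ∉ w₂.1 ∧ I.vars e 3 ∉ w₂.1) : J₀.card ≤ 5 := by
  obtain ⟨B, κ₀, hJ, hD⟩ := gateData_of_terminal I hI hT hS hB ht hF hP hmax hch he hg₀ hgv hu hun hfv hbl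
  rw [← hJ]
  exact hC n m r I hI hT hS hB B e g₀ u κ₀ hD

/-- **`GateCount ⟹ TerminalFiveCotree1Blind`** (both orientations of the gate's private; slot `3` through `swapAnd I e`). -/
theorem cotree1Blind_of_gateCount (hC : GateCount) : TerminalFiveCotree1Blind := by
  intro n m r I hI hT hS hB y J₀ w₁ w₂ ht F hF hP hmax hch g₀ hg₀ sp hcg hun h2 h3 hbl
  classical
  obtain ⟨hsp, hpriv, hu⟩ := hcg
  -- name the private `v` and the partner `u`
  obtain ⟨v, u, hgv, hvp, hu', hfv, hbl'⟩ : ∃ v u : Fin n, ((I.vars g₀ 2 = v ∧ I.vars g₀ 3 = u) ∨ (I.vars g₀ 2 = u ∧ I.vars g₀ 3 = v)) ∧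
      v ∈ privs I (J₀ \ F) ∧ (∃ j₀ ∈ F, u = I.vars j₀ 2 ∨ u = I.vars j₀ 3) ∧
      (∀ c : Bool, SatPair I y J₀ (({v} : Finset (Fin n)), (∅ : Finset (Fin m)), c) w₂) ∧
      (∀ e ∈ J₀ \ F, (I.vars e 2 = v ∨ I.vars e 3 = v) → I.vars e 2 ∉ w₂.1 ∧ I.vars e 3 ∉ w₂.1) := by
    rcases hsp with rfl | rfl
    · rw [if_pos rfl] at hu
      exact ⟨_, _, Or.inl ⟨rfl, rfl⟩, hpriv, hu, h2, hbl⟩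
    · rw [if_neg (by decide)] at hu
      exact ⟨_, _, Or.inr ⟨rfl, rfl⟩, hpriv, hu, h3, hbl⟩
  obtain ⟨e, he, hev⟩ := (mem_privs I).1 hvp
  rcases hev with hev | hev
  · -- orientation `2`
    subst hev
    exact card_le_five_of_gateCount₂ hC I hI hT hS hB ht hF hP hmax hch he hg₀ hgv hu' hun hfv (hbl' e he (Or.inl rfl))
  · -- orientation `3`: swap the AND slots of `e`
    subst hev
    set I' := swapAnd I e with hI'
    have hv2 : I'.vars e 2 = I.vars e 3 := (swapAnd_vars_two I e).1
    have hv3 : I'.vars e 3 = I.vars e 2 := (swapAnd_vars_two I e).2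
    have hvo : ∀ {j : Fin m}, j ≠ e → ∀ s, I'.vars j s = I.vars j s := fun hj s => swapAnd_vars_of_ne I hj s
    have hg₀e : g₀ ≠ e := by
      obtain ⟨-, -, -, hd₁, -⟩ := id ht
      exact fun h => Finset.disjoint_left.1 hd₁ (mem_sdiff.1 he).1 (h ▸ hg₀)
    have hch' : ∀ e' ∈ J₀ \ F, IsChord I' J₀ e' := fun e' he' => (isChord_swapAnd I e J₀ e').2 (hch e' he')
    have hprivs : privs I' (J₀ \ F) = privs I (J₀ \ F) := privs_swapAnd I e _
    have hsat : ∀ c : Bool, SatPair I' y J₀ (({I'.vars e 2} : Finset (Fin n)), (∅ : Finset (Fin m)), c) w₂ := by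
      intro c
      obtain ⟨x, hx, h1, h2'⟩ := hfv c
      refine ⟨x, fun j hj => by rw [hI', eval_swapAnd hI]; exact hx j hj, ?_, ?_⟩
      · rw [hv2, hI', gval_swapAnd]; exact h1
      · rw [hI', gval_swapAnd]; exact h2'
    refine card_le_five_of_gateCount₂ hC I' (isPure_swapAnd hI e) (typed_swapAnd hT e) (simpleOverlap_swapAnd hS e)
      (boundaryExpanding_swapAnd hB e) ((terminal_swapAnd hI e r y J₀ w₁ w₂).2 ht) hF ((peelable_swapAnd I e F).2 hP)
      (fun F' h1 h2 h3 => hmax F' h1 h2 ((peelable_swapAnd I e F').1 h3)) hch' he hg₀ (u := u) ?_ ?_ ?_ hsat ?_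
    · rw [hvo hg₀e, hvo hg₀e, hv2]; exact hgv
    · obtain ⟨j₀, hj₀, hju⟩ := hu'
      have hj₀e : j₀ ≠ e := fun h => (mem_sdiff.1 he).2 (h ▸ hj₀)
      exact ⟨j₀, hj₀, by rw [hvo hj₀e, hvo hj₀e]; exact hju⟩
    · intro g hg w hw
      rw [hprivs] at hw
      have hge : g ≠ e := by
        obtain ⟨-, -, -, hd₁, hd₂, -⟩ := id ht
        rcases mem_union.1 hg with hg | hg
        · exact fun h => Finset.disjoint_left.1 hd₁ (mem_sdiff.1 he).1 (h ▸ mem_of_mem_erase hg)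
        · exact fun h => Finset.disjoint_left.1 hd₂ (mem_sdiff.1 he).1 (h ▸ hg)
      rw [hvo hge, hvo hge]
      exact hun g hg w hw
    · rw [hv2, hv3]; exact (hbl' e he (Or.inr rfl)).symm

end Summit.PneNP.PneNP.Theorems.PstarGateNodes
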